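import Literature.Barriers.CriticalPhenomena.RigorousRGSmallParameterHHWWindow
import Literature.Probability.LatticeModels.GaussianPairingBound
import HarnessLib

/-!
# Monotonicity in the Ising parameter of all moments along the Hara–Hattori–Watanabe trajectory

Companion of `RigorousRGSmallParameterHHWWindow.lean` (which proves observation (2) of HHW §2.3,
"`μ_{2,N}` is increasing in `s`", as `HierarchicalRG.mu2_traj_mono`, from the tree's Griffiths
inequalities). Hara–Hattori–Watanabe (CMP 220 (2001) 13–40) use in §5.3 (3), eq. (5.34), "the
monotonicity of `a_{n,N}(s)` with respect to `s`" for the Taylor coefficients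
`a_{n,N} = n! m_{2n}/(2n)!` ((5.1)) of `ĥ_N`, to pass from the two computed endpoints `s±` to the
whole interval `[s₋, s₊]`. Here this is PROVED for every moment: with `h_N` the law of the block
spin `s(√c/2)^N Σᵢσᵢ` of the hierarchical ferromagnet with couplings `J⁽ᴺ⁾(s) = s²J⁽ᴺ⁾(1) ≥ 0`
(`traj_eq_isingMagnetizationLaw`, `…HHWGibbs`), `m_k(h_N) = (s(√c/2)^N)^k Σ_{f : [k] → Λ} ⟨∏ⱼ σ_{f j}⟩`
and `∏ⱼ σ_{f j} = σ_{oddSupport f}` (`prod_spinAt_eq_spinProduct_oddSupport`), so each summand is a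
Griffiths correlation, non-negative (GKS I) and non-decreasing in the couplings (GKS II, the
tree's `gksExpect_mono_of_abs_le`): `moment_traj_mono`, `taylorA_traj_mono`.

## References

* T. Hara, T. Hattori, H. Watanabe, Comm. Math. Phys. 220 (2001) 13–40, §2.3 (2) and §5.3 (3),
  eq. (5.34).
* S. Friedli, Y. Velenik, *Statistical Mechanics of Lattice Systems*, CUP 2017, §3.8.1 (GKS).
-/

noncomputable section

namespace Literature.Barriers.CriticalPhenomena

open _root_.MeasureTheory _root_.ProbabilityTheory _root_.Filter _root_.Set
open Literature.Probability.LatticeModels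
open scoped _root_.Topology BigOperators

namespace HierarchicalRG

/-- **Moments along the trajectory as sums of Griffiths correlations**:
`m_k(h_N) = (s(√c/2)^N)^k Σ_{f : Fin k → Λ_N} ⟨σ_{oddSupport f}⟩_{J⁽ᴺ⁾(s)}`.
[cite: HaraHattoriWatanabe2001, §2.2 eq. (2.9)] -/
theorem moment_traj_eq_sum_gksExpect (s : ℝ) (N k : ℕ) :
    moment id k (traj s N) = (s * hierK ^ N) ^ k *
      ∑ f : Fin k → Fin (2 ^ N), gksExpect Finset.univ
        (fun p : Fin (2 ^ N) × Fin (2 ^ N) => hierCoupling s N p.1 p.2) pairSupp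
        (spinProduct (oddSupport f)) := by
  classical
  rw [moment_id_eq, traj_eq_isingMagnetizationLaw,
    integral_isingMagnetizationLaw _ _ (continuous_pow k).measurable]
  simp only [weightedMagnetization_hierWeight]
  have hpow : ∀ σ : Fin (2 ^ N) → Bool, (s * hierK ^ N * ∑ i, spinVal σ i) ^ k =
      (s * hierK ^ N) ^ k * ∑ f : Fin k → Fin (2 ^ N), ∏ j, spinVal σ (f j) := by
    intro σ
    rw [mul_pow, Finset.sum_pow', Fintype.piFinset_univ]
  have hprod : ∀ (σ : Fin (2 ^ N) → Bool) (f : Fin k → Fin (2 ^ N)),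
      ∏ j, spinVal σ (f j) = spinProduct (oddSupport f) (spinEquiv (2 ^ N) σ) := by
    intro σ f
    rw [← prod_spinAt_eq_spinProduct_oddSupport]
    exact Finset.prod_congr rfl fun j _ => (spinAt_spinEquiv σ (f j)).symm
  simp_rw [hpow]
  have hswap : (∑ σ : Fin (2 ^ N) → Bool, isingBoltzmann (hierCoupling s N) σ /
      isingPairPartition (hierCoupling s N) *
        ((s * hierK ^ N) ^ k * ∑ f : Fin k → Fin (2 ^ N), ∏ j, spinVal σ (f j))) =
      (s * hierK ^ N) ^ k * ∑ f : Fin k → Fin (2 ^ N), ∑ σ : Fin (2 ^ N) → Bool,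
        isingBoltzmann (hierCoupling s N) σ / isingPairPartition (hierCoupling s N) *
          ∏ j, spinVal σ (f j) := by
    calc (∑ σ : Fin (2 ^ N) → Bool, isingBoltzmann (hierCoupling s N) σ /
          isingPairPartition (hierCoupling s N) *
            ((s * hierK ^ N) ^ k * ∑ f : Fin k → Fin (2 ^ N), ∏ j, spinVal σ (f j)))
        = ∑ σ : Fin (2 ^ N) → Bool, ∑ f : Fin k → Fin (2 ^ N), (s * hierK ^ N) ^ k *
            (isingBoltzmann (hierCoupling s N) σ / isingPairPartition (hierCoupling s N) *
              ∏ j, spinVal σ (f j)) := by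
          refine Finset.sum_congr rfl fun σ _ => ?_
          rw [Finset.mul_sum, Finset.mul_sum]
          refine Finset.sum_congr rfl fun f _ => ?_
          ring
      _ = ∑ f : Fin k → Fin (2 ^ N), ∑ σ : Fin (2 ^ N) → Bool, (s * hierK ^ N) ^ k *
            (isingBoltzmann (hierCoupling s N) σ / isingPairPartition (hierCoupling s N) *
              ∏ j, spinVal σ (f j)) := Finset.sum_comm
      _ = _ := by
          rw [Finset.mul_sum]
          refine Finset.sum_congr rfl fun f _ => ?_
          rw [Finset.mul_sum]
  rw [hswap]
  congr 1
  refine Finset.sum_congr rfl fun f _ => ?_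
  rw [sum_div_eq_gksExpect]
  congr 1
  funext ω
  rw [hprod, Equiv.apply_symm_apply]

/-- **Every moment `m_k(h_N)(s)` is non-decreasing in `s ≥ 0`** (Griffiths I and II for the
hierarchical ferromagnet, `J⁽ᴺ⁾(s) = s²J⁽ᴺ⁾(1)`). [cite: HaraHattoriWatanabe2001, §5.3 (3) eq. (5.34)] -/
theorem moment_traj_mono (N k : ℕ) : MonotoneOn (fun s : ℝ => moment id k (traj s N)) (Set.Ici 0) := by
  classical
  intro s hs s' hs' hss'
  simp only [moment_traj_eq_sum_gksExpect]
  have hs0 : (0 : ℝ) ≤ s := hs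
  have hJabs : ∀ p ∈ (Finset.univ : Finset (Fin (2 ^ N) × Fin (2 ^ N))),
      |hierCoupling s N p.1 p.2| ≤ hierCoupling s' N p.1 p.2 := by
    intro p _
    rw [abs_of_nonneg (hierCoupling_nonneg s N _ _), hierCoupling_eq_sq_mul s, hierCoupling_eq_sq_mul s']
    exact mul_le_mul_of_nonneg_right (pow_le_pow_left₀ hs0 hss' 2) (hierCoupling_nonneg 1 N _ _)
  have hsum_mono : ∑ f : Fin k → Fin (2 ^ N), gksExpect Finset.univ
        (fun p : Fin (2 ^ N) × Fin (2 ^ N) => hierCoupling s N p.1 p.2) pairSupp (spinProduct (oddSupport f)) ≤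
      ∑ f : Fin k → Fin (2 ^ N), gksExpect Finset.univ
        (fun p : Fin (2 ^ N) × Fin (2 ^ N) => hierCoupling s' N p.1 p.2) pairSupp (spinProduct (oddSupport f)) :=
    Finset.sum_le_sum fun f _ => gksExpect_mono_of_abs_le _ _ hJabs _
  have hsum_nonneg : 0 ≤ ∑ f : Fin k → Fin (2 ^ N), gksExpect Finset.univ
        (fun p : Fin (2 ^ N) × Fin (2 ^ N) => hierCoupling s N p.1 p.2) pairSupp (spinProduct (oddSupport f)) :=
    Finset.sum_nonneg fun f _ => gksExpect_spinProduct_nonneg _ _ _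
      (fun q _ => hierCoupling_nonneg s N _ _) _
  have hk : 0 ≤ hierK ^ N := (pow_pos hierK_pos N).le
  have hpre : (s * hierK ^ N) ^ k ≤ (s' * hierK ^ N) ^ k :=
    pow_le_pow_left₀ (mul_nonneg hs0 hk) (mul_le_mul_of_nonneg_right hss' hk) k
  calc (s * hierK ^ N) ^ k * _ ≤ (s' * hierK ^ N) ^ k * _ :=
        mul_le_mul_of_nonneg_right hpre hsum_nonneg
    _ ≤ (s' * hierK ^ N) ^ k * _ :=
        mul_le_mul_of_nonneg_left hsum_mono (pow_nonneg (mul_nonneg (hs0.trans hss') hk) k)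

/-- **The Taylor coefficients `a_{n,N}(s) = n! m_{2n}/(2n)!` ((5.1)) are non-decreasing in
`s ≥ 0`** — "the monotonicity of `a_{n,N}(s)` with respect to `s`" used in §5.3 (3), eq. (5.34)
(and, for `n = 1`, observation (2) of §2.3). [cite: HaraHattoriWatanabe2001, §5.3 (3) eq. (5.34)] -/
theorem taylorA_traj_mono (N n : ℕ) : MonotoneOn (fun s : ℝ => taylorA (traj s N) n) (Set.Ici 0) := by
  intro s hs s' hs' hss'
  simp only [taylorA]
  exact mul_le_mul_of_nonneg_left (moment_traj_mono N (2 * n) hs hs' hss') (by positivity)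

end HierarchicalRG

end Literature.Barriers.CriticalPhenomena

end
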